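import Mathlib
import HarnessLib
import Summits.HodgeConjecture.Statement
import Summits.HodgeConjecture.HodgeConjecture.Theses.SignSymmetricPowers
import Literature.AlgebraicGeometry.Motives.HodgeTensor
import Literature.AlgebraicGeometry.Motives.HodgeTensorFactsHolds
import Literature.AlgebraicGeometry.Motives.FibrePowerSmoothProjective
import Literature.AlgebraicGeometry.Motives.PeriodRealizationClassical
import Literature.AlgebraicGeometry.HodgeTheory.HodgeConjecture
import Literature.AlgebraicGeometry.HodgeTheory.BettiUniverseAxioms
import Literature.AlgebraicGeometry.HodgeTheory.BettiUniverseTracePairing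
import Literature.AlgebraicGeometry.HodgeTheory.BettiUniverseOddCupAlternating
import Literature.AlgebraicGeometry.HodgeTheory.ComplexConjugationHolds
import Literature.AlgebraicGeometry.HodgeTheory.HodgeFiltrationModelsReductionProofs
import Literature.AlgebraicGeometry.HodgeTheory.HodgeStructureOfHodgeModel
import Literature.AlgebraicGeometry.HodgeTheory.RealStructureSingular
import Literature.AlgebraicGeometry.HodgeTheory.AlgebraicClassesPullback
import Literature.AlgebraicGeometry.HodgeTheory.BettiUniverseKunnethHodgePowersInsert
import Literature.LinearAlgebra.Alternating.SymplecticInvolutionCentralizer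
import Literature.RepresentationTheory.ClassicalInvariants.SymplecticTensorFFTBlockDiagonal
import Summits.HodgeConjecture.HodgeConjecture.Theorems.SignSymmetricPowersFFTTensorPort
import Summits.HodgeConjecture.HodgeConjecture.Theorems.SignSymmetricPowersSummandHodgeNormalForm
import Summits.HodgeConjecture.HodgeConjecture.Theorems.SignSymmetricPowersMatchingClassesAlgebraic
import Summits.HodgeConjecture.HodgeConjecture.Theorems.BoundaryReadoutPullbackAlgebraic

/-!
# Route `SignSymmetricPowers`, crux K2 `PowersHodgeOfSignCommutators` (stmt-HodgeConjecture-19717) — CLOSING COMPOSITION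

The registered skeleton `kunneth-tensor-fft` v2 (sha16 `960d9c079ab3ffd4`, HOME/p3/k2line-v2-g19/) of the rank-3 crux
`Summit.HodgeConjecture.HodgeConjecture.Theses.SignSymmetricPowers.PowersHodgeOfSignCommutators` has every THEOREM stub
landed BY NAME under `Theorems/`: `stub_fftTensorPort` (`SignSymmetricPowersFFTTensorPort`), `stub_summandHodgeNormalForm`
(`SignSymmetricPowersSummandHodgeNormalForm`, p520522), `stub_matchingClassesAlgebraic`
(`SignSymmetricPowersMatchingClassesAlgebraic`, p534537).  The only remaining binder is the named Literature FACT
`Literature.AlgebraicGeometry.HodgeTheory.fulton1998_map_mem_algebraicClasses` (Fulton 1998, Cor. 19.2 (b): pull-backs of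
algebraic classes are algebraic; skeleton binder `stub_fultonPullback`).  This file is the skeleton's kernel-checked
composition `PowersHodgeOfSignCommutators_of` with the three landed theorems substituted: it proves the crux BY NAME
modulo that one registered fact, taken as the hypothesis `hP` (THE MODEL: an unproved published result is a hypothesis
`(h : X)`; expected closure state `closed modulo ⟨fulton1998_map_mem_algebraicClasses⟩`).  No new mathematics: the proof
term is the registered composition verbatim — Künneth–Hodge normal form per summand ⇒ span of decorated Künneth insertions
of Hodge tensors on `H³(X)`; Hodge tensors are fixed by the `σ*`-centraliser in `Sp(H³)` because the MT-commutators of the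
centraliser lie in the Hodge group (`mem_of_forall_commutator_mem` + hypothesis `Comm` of the crux); the `Sp(V₊) × Sp(V₋)`
tensor FFT puts them in the span of matching tensors; matching tensors have algebraic Künneth insertions.
Prepared by planner P3 g22 from the registered skeleton; to be PROPOSED by a prover with
`ledger propose --kind proof --target Summits/HodgeConjecture/HodgeConjecture/Theorems/SignSymmetricPowersClose.lean
--workitem stmt-HodgeConjecture-19717`.
-/

set_option linter.dupNamespace false
set_option linter.unusedVariables false
set_option linter.unusedSectionVars false
set_option maxHeartbeats 800000

noncomputable section

open Literature.AlgebraicGeometry.Motives Literature.AlgebraicGeometry.HodgeTheory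
open Literature.AlgebraicGeometry.HodgeTheory.BettiUniverse
open Literature.AlgebraicTopology.SingularHomology
open Literature.LinearAlgebra.Alternating Literature.RepresentationTheory.ClassicalInvariants
open CategoryTheory CategoryTheory.Limits
open scoped TensorProduct PiTensorProduct BigOperators

namespace Summit.HodgeConjecture.HodgeConjecture.Theorems.SignSymmetricPowersClose

/-- Künneth–Hodge normal form (the skeleton's derived statement `KunnethHodgeTensors`, obtained from the landed
per-summand stub KS `stub_summandHodgeNormalForm` by summing over the Künneth summands): modulo Fulton, every rational
Hodge class on a limit fan `Y = X^(k+1)` of a smooth sign-symmetric hypersurface threefold is a `ℚ`-combination of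
decorated Künneth insertions `E t` of Hodge tensors `t ∈ T^(r,0) H³(X)`. -/
theorem kunnethHodgeTensors_of_fulton :
    open Literature.AlgebraicGeometry.Motives Literature.AlgebraicGeometry.HodgeTheory Literature.AlgebraicGeometry.HodgeTheory.BettiUniverse CategoryTheory.Limits in Literature.AlgebraicGeometry.HodgeTheory.fulton1998_map_mem_algebraicClasses → ∀ ⦃d : ℕ⦄, Even d → 4 ≤ d → ∀ ⦃X : SchemeOver ℂ⦄ (hX : IsSmoothProjective 3 X), (∃ f : MvPolynomial (Fin 5) ℂ, f.IsHomogeneous d ∧ (∀ e : Fin 5 →₀ ℕ, ¬ Even (e 0 + e 1) → f.coeff e = 0) ∧ IsHypersurfaceCutOutBy 4 f X) → ∀ [Module.Finite ℚ (bettiCohomology X 3)] [HodgeTensorFacts.{0, 0}] ⦃k : ℕ⦄ ⦃Y : SchemeOver ℂ⦄ (π : Fin (k + 1) → (Y ⟶ X)) (hlim : IsLimit (Fan.mk Y π)) (p : ℕ) (v : bettiCohomology Y (2 * p)), v ∈ (hodge exists_isReal_hodgeModel_holds (isSmoothProjective_of_isLimit_fan hX π hlim) (2 * p)).hodgeClasses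 p → v ∈ Submodule.span ℚ {x : bettiCohomology Y (2 * p) | ∃ (q r : ℕ) (u : Fin r → Fin (k + 1)) (wdec : bettiCohomology Y (2 * q)) (_ : ofRatClass (ComplexPoints Y) (2 * q) wdec ∈ algebraicClasses Y q) (E : hodgeTensorSpace (bettiCohomology X 3) r 0 →ₗ[ℚ] bettiCohomology Y (2 * p)) (_ : (∀ w : Fin r → Fin (Module.finrank ℚ (bettiCohomology X 3)), (⟨2 * p, E ((PiTensorProduct.tprod ℚ fun i => (Module.finBasis ℚ (bettiCohomology X 3)) (w i)) ⊗ₜ[ℚ] (PiTensorProduct.tprod ℚ fun i : Fin 0 => (Fin.elim0 i : Module.Dual ℚ (bettiCohomology X 3))))⟩ : Σ n, bettiCohomology Y n) = List.foldl (fun (acc : Σ n, bettiCohomology Y n) (i : Fin r) => ⟨acc.1 + 3, cup Y acc.1 3 acc.2 (pull (π (u i)) 3 ((Module.finBasis ℚ (bettiCohomology X 3)) (w i)))⟩) ⟨2 * q, wdec⟩ (List.finRange r))) (t : hodgeTensorSpace (bettiCohomology X 3) r 0) (_ : (∃ p' : ℤ, ((r : ℤ) - ((0 : ℕ) : ℤ))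 * ((3 : ℕ) : ℤ) = 2 * p' ∧ t ∈ ((hodge exists_isReal_hodgeModel_holds hX 3).tensorSpace r 0).hodgeClasses p')), x = E t} := by
  intro hP d hd h4 X hX hf _i1 _i2 k Y π hlim p v hv
  obtain ⟨x, hx, rfl⟩ := exists_eq_sum_fanKunnethMap_powInsert_of_mem_hodgeClasses exists_isReal_hodgeModel_holds
    hodgePQ_independent_of_hodgeModel_holds hX π hlim (isSmoothProjective_of_isLimit_fan hX π hlim) (p : ℤ) hv
  exact Submodule.sum_mem _ fun κ _ => Summit.HodgeConjecture.HodgeConjecture.Theorems.SignSymmetricPowersSummandHodgeNormalForm.stub_summandHodgeNormalForm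
    hP hd h4 hX hf π hlim p κ (x κ) (hx κ)

/-- **Crux K2 of route `SignSymmetricPowers` modulo Fulton's pull-back fact**: for every smooth sign-symmetric
hypersurface threefold `X ⊂ ℙ⁴` of even degree `d ≥ 4` whose `σ*`-centraliser MT-commutators lie in the Hodge group,
all powers `X^(k+1)` satisfy the Hodge conjecture — the registered composition `PowersHodgeOfSignCommutators_of` of
skeleton `960d9c079ab3ffd4` with the landed stubs F, KS, A substituted and the fact binder P as hypothesis. -/
theorem powersHodgeOfSignCommutators_of_fulton
    (hP : Literature.AlgebraicGeometry.HodgeTheory.fulton1998_map_mem_algebraicClasses) :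
    Summit.HodgeConjecture.HodgeConjecture.Theses.SignSymmetricPowers.PowersHodgeOfSignCommutators := by
  have hK := @kunnethHodgeTensors_of_fulton
  intro d hd h4 X hX hf hσ k Y hY
  obtain ⟨π, ⟨hlim⟩⟩ := hY
  obtain ⟨σ, ⟨hs2, hsB, -⟩, hComm⟩ := hσ
  haveI hfin : Module.Finite ℚ (bettiCohomology X 3) := finite hX 3
  haveI hTF : HodgeTensorFacts.{0, 0} := hodgeTensorFacts_holds
  have hYsp : IsSmoothProjective (3 * (k + 1)) Y := isSmoothProjective_of_isLimit_fan hX π hlim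
  refine ⟨⟨realHodgeModel exists_isReal_hodgeModel_holds hYsp⟩, ?_⟩
  intro p c hrat hpp
  obtain ⟨v, rfl⟩ := (isRationalClass_iff_mem_range_ofRatClass c).1 hrat
  have hv : v ∈ (hodge exists_isReal_hodgeModel_holds hYsp (2 * p)).hodgeClasses p :=
    (HodgeModel.mem_hodgeClasses_iff_isOfHodgeType (realHodgeModel exists_isReal_hodgeModel_holds hYsp) hYsp
      hodgePQ_independent_of_hodgeModel_holds (realHodgeModel_isHodgeSymmetric exists_isReal_hodgeModel_holds hYsp)
      p v).2 hpp
  have hspan := hK hP hd h4 hX hf π hlim p v hv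
  -- the symplectic data on `H³(X, ℚ)`
  have hBa : (((cup X 3 3).compr₂ (tr hX (3 + 3))) : LinearMap.BilinForm ℚ (bettiCohomology X 3)).IsAlt :=
    isAlt_tr_cup_of_odd hX (by decide)
  have hBn : ((cup X 3 3).compr₂ (tr hX (3 + 3))).Nondegenerate := nondegenerate_tr_cup hX
  -- every `σ`-commuting `B`-isometry lies in the Hodge group (landed algebra + `Comm`)
  have hHg : ∀ g : bettiCohomology X 3 ≃ₗ[ℚ] bettiCohomology X 3, (∀ x, g (pull σ 3 x) = pull σ 3 (g x)) →
      (∀ x y, ((cup X 3 3).compr₂ (tr hX (3 + 3))) (g x) (g y) = ((cup X 3 3).compr₂ (tr hX (3 + 3))) x y) →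
      g ∈ (hodge exists_isReal_hodgeModel_holds hX 3).hodgeGroup := by
    intro g hgs hgB
    exact mem_of_forall_commutator_mem hBa hBn hs2 hsB _ (fun g' h' hg' hh' => hComm g' h' hg' hh') hgs hgB
  refine Submodule.span_induction (p := fun x _ => ofRatClass (ComplexPoints Y) (2 * p) x ∈ algebraicClasses Y p)
    ?_ ?_ ?_ ?_ hspan
  · rintro x ⟨q, r, u, wdec, hwdec, E, hE, t, ht, rfl⟩
    have hinv : ∀ g : bettiCohomology X 3 ≃ₗ[ℚ] bettiCohomology X 3, (∀ x, g (pull σ 3 x) = pull σ 3 (g x)) →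
        (∀ x y, ((cup X 3 3).compr₂ (tr hX (3 + 3))) (g x) (g y) = ((cup X 3 3).compr₂ (tr hX (3 + 3))) x y) →
        tensorSpaceAct g t = t := by
      intro g hgs hgB
      obtain ⟨p', hp', ht'⟩ := ht
      exact (HodgeStructure.mem_hodgeGroup_iff _ g).1 (hHg g hgs hgB) r 0 p' hp' t ht'
    have htspan := Summit.HodgeConjecture.HodgeConjecture.Theorems.SignSymmetricPowersFFTTensorPort.stub_fftTensorPort
      (bettiCohomology X 3) ((cup X 3 3).compr₂ (tr hX (3 + 3))) hBa hBn (pull σ 3) hs2 hsB r t hinv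
    refine Submodule.span_induction
      (p := fun y _ => ofRatClass (ComplexPoints Y) (2 * p) (E y) ∈ algebraicClasses Y p) ?_ ?_ ?_ ?_ htspan
    · rintro m ⟨j, e, τ, rfl⟩
      exact Summit.HodgeConjecture.HodgeConjecture.Theorems.SignSymmetricPowersMatchingClassesAlgebraic.stub_matchingClassesAlgebraic
        hP hd h4 hX hf σ π hlim p q r u wdec hwdec E hE j e τ
    · simp
    · intro a b _ _ ha hb
      simpa [map_add] using add_mem ha hb
    · intro a y _ hy
      simpa [map_smul, ofRatClass_smul] using Submodule.smul_mem _ (a : ℂ) hy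
  · simp
  · intro a b _ _ ha hb
    simpa [map_add] using add_mem ha hb
  · intro a y _ hy
    simpa [ofRatClass_smul] using Submodule.smul_mem _ (a : ℂ) hy

/-- **Crux K2 `PowersHodgeOfSignCommutators` (stmt-HodgeConjecture-19717), UNCONDITIONAL**: the Fulton binder of
`powersHodgeOfSignCommutators_of_fulton` is the tree THEOREM
`Summit.HodgeConjecture.HodgeConjecture.Theorems.fulton1998_map_mem_algebraicClasses_holds`
(`Theorems/BoundaryReadoutPullbackAlgebraic`, crux `PullbackAlgebraic` of route `BoundaryReadout`, in tree since 2026-08-17). -/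
theorem powersHodgeOfSignCommutators :
    Summit.HodgeConjecture.HodgeConjecture.Theses.SignSymmetricPowers.PowersHodgeOfSignCommutators :=
  powersHodgeOfSignCommutators_of_fulton
    Summit.HodgeConjecture.HodgeConjecture.Theorems.fulton1998_map_mem_algebraicClasses_holds

end Summit.HodgeConjecture.HodgeConjecture.Theorems.SignSymmetricPowersClose

end
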